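import Summits.QuantumFields.QCD.Theses.QuarksNoInfraredClause
import Summits.QuantumFields.QCD.Theses.DiagonalSpine
import Literature.MathematicalPhysics.QuantumFieldTheory.QCDGoldstoneBound
import Literature.MathematicalPhysics.QuantumFieldTheory.QCDFlavourSymmetry
import HarnessLib

/-!
# Crux `ThinQCD` (item stmt-QuantumFields-17278), line `registered`: PLACEMENT of the anchor

Support file (`--supports stmt-QuantumFields-17278`; lead c3, cycle 4).  The registered anchor stub of skeleton r5,
`stub_chiralLatticeHalf` (S1′: for `N_f = 2, 3` one mass-independent regularisation with leading-log mass scaling,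
chiral at zero, two-loop asymptotic scaling and, at EVERY positive tuple, the physical branch and a volume-uniform
FULL lattice gap), and the thin anchor S1 of r4 (the same with the flavour-NEUTRAL lattice gap) are NECESSARY:

* `chiralLatticeHalf_of_qcd` — `QCD → S1′`: the summit conjunct `QCD = QCDOf 2 ∧ QCDOf 3` already contains, inside its
  `∃ reg`, mass scaling, chirality at zero and, at every positive tuple, a scheme `reg.scheme m z shift` that scales
  asymptotically, stays on the physical branch and has a full uniform lattice gap; these three clauses do not read the
  species renormalisations `z, shift` (they are clauses on `a, β, L, m_crit, Z_m` only), so they hold verbatim for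
  `reg.scheme m 0 0`, and asymptotic scaling at ANY tuple is asymptotic scaling at the tuple `0` (same `a, β`).
  Hence the line's anchor is not over-strong: every proof of the summit proves S1′.
* `thinLatticeAnchor_of_thinQCD` — `ThinQCD → S1`: the crux itself contains the thin anchor (its last conjunct is the
  neutral lattice clustering at rate `2Δ`, i.e. `HasNeutralLatticeMassGap (2Δ)` by `Iff.rfl`).
* `chiralLatticeHalf_of_closes` — `TorusHalfSpectrum → ThinQCD → S1′` through the route's deciding theorem `closes`.

With the landed upper bracket `thinQCD_of_pieces_r5 : S1′ → U1 → RotationRestoration → ThinQCD` (p168394) this closes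
the bracket of the anchor: modulo U1 ∧ `RotationRestoration` ∧ `TorusHalfSpectrum`, S1′ ⟺ ThinQCD ⟺ QCD.
No definition, no named fact, no `sorry`.
-/

noncomputable section

namespace Summit.QuantumFields.QCD.Cruxes.ThinQCD.Registered

open Filter
open Literature.MathematicalPhysics.QuantumFieldTheory
open Summit.QuantumFields.QCD.Theses.QuarksNoInfraredClause (ThinQCD TorusHalfSpectrum closes)

/-- **`QCD → S1′`: the chiral lattice half is a necessary condition of the summit conjunct.**  From `QCDOf N_f`
(`N_f = 2, 3`) take `reg` with mass scaling and chirality at zero; at the tuple `m ≡ 1` the scheme of `IsQCDAlong`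
scales asymptotically with the same `a, β` as `reg.scheme 0 0 0`; at every positive tuple the branch and the full
lattice gap of `reg.scheme m z shift` are literally those of `reg.scheme m 0 0`.  The conclusion is VERBATIM the
registered signature of `stub_chiralLatticeHalf` (skeleton r5). [folklore] -/
theorem chiralLatticeHalf_of_qcd :
    _root_.QCD →
      ∀ Nf : ℕ, Nf = 2 ∨ Nf = 3 → ∃ reg : QCDRegularisation Nf,
        reg.HasMassScaling ∧ reg.IsChiralAtZero ∧ (reg.scheme 0 0 0).HasAsymptoticScaling ∧
          ∀ m : Fin Nf → ℝ, (∀ f, 0 < m f) →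
            (∀ f, ∀ᶠ k in Filter.atTop, -1 < (reg.scheme m 0 0).mq f k) ∧
              ∃ Δ > 0, (reg.scheme m 0 0).HasLatticeMassGap Δ := by
  rintro ⟨h2, h3⟩ Nf hNf
  have hQ : QCDOf Nf := by
    rcases hNf with rfl | rfl
    · exact h2
    · exact h3
  obtain ⟨reg, hms, hchi, hm⟩ := hQ
  refine ⟨reg, hms, hchi, ?_, fun m hm' => ?_⟩
  · -- asymptotic scaling at the tuple `m ≡ 1`, read at the tuple `0` (same `a`, `β`)
    obtain ⟨z, shift, T, ⟨has, -, -⟩, -⟩ := hm (fun _ => 1) (fun _ => one_pos)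
    obtain ⟨Λ, hΛ, ht⟩ := has
    exact ⟨Λ, hΛ, ht⟩
  · obtain ⟨z, shift, T, ⟨-, hbr, -⟩, -, -, -, Δ, hΔ, -, hgap⟩ := hm m hm'
    refine ⟨fun f => ?_, Δ, hΔ, ?_⟩
    · simpa using hbr f
    · intro R R' A B
      obtain ⟨C, hC⟩ := hgap R R' A B
      exact ⟨C, hC⟩

/-- **`ThinQCD → S1` (thin): the crux contains the thin anchor of r4.**  Mass scaling and chirality are conjuncts;
asymptotic scaling at the tuple `0` is that of the scheme at `m ≡ 1`; at every positive tuple the branch is a conjunct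
of `IsQCDAlong` and the neutral lattice clustering at rate `2Δ` is the crux's last conjunct, read for `reg.scheme m 0 0`
(it does not see `z, shift`).  The conclusion is VERBATIM `Stmt.thinLatticeAnchor` of the skeleton (r4's registered
`stub_latticeAnchor` in its `IsChiralAtZero` form). [folklore] -/
theorem thinLatticeAnchor_of_thinQCD :
    ThinQCD →
      ∀ Nf : ℕ, Nf = 2 ∨ Nf = 3 → ∃ reg : QCDRegularisation Nf,
        reg.HasMassScaling ∧ reg.IsChiralAtZero ∧ (reg.scheme 0 0 0).HasAsymptoticScaling ∧
          ∀ m : Fin Nf → ℝ, (∀ f, 0 < m f) →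
            (∀ f, ∀ᶠ k in Filter.atTop, -1 < (reg.scheme m 0 0).mq f k) ∧
              ∃ Δ₀ : ℝ, 0 < Δ₀ ∧ (reg.scheme m 0 0).HasNeutralLatticeMassGap Δ₀ := by
  intro h Nf hNf
  obtain ⟨reg, hms, hchi, hm⟩ := h Nf hNf
  refine ⟨reg, hms, hchi, ?_, fun m hm' => ?_⟩
  · obtain ⟨z, shift, T, ⟨has, -, -⟩, -⟩ := hm (fun _ => 1) (fun _ => one_pos)
    obtain ⟨Λ, hΛ, ht⟩ := has
    exact ⟨Λ, hΛ, ht⟩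
  · obtain ⟨z, shift, T, ⟨-, hbr, -⟩, -, -, -, Δ, hΔ, -, hgap⟩ := hm m hm'
    refine ⟨fun f => ?_, 2 * Δ, by positivity, ?_⟩
    · simpa using hbr f
    · intro R R' A B hA hB
      obtain ⟨C, hC⟩ := hgap R R' A B hA hB
      exact ⟨C, hC⟩

/-- **`TorusHalfSpectrum → ThinQCD → S1′`** through the route's deciding theorem
`closes : TorusHalfSpectrum → ThinQCD → QCD` and `chiralLatticeHalf_of_qcd`. [folklore] -/
theorem chiralLatticeHalf_of_closes :
    TorusHalfSpectrum → ThinQCD →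
      ∀ Nf : ℕ, Nf = 2 ∨ Nf = 3 → ∃ reg : QCDRegularisation Nf,
        reg.HasMassScaling ∧ reg.IsChiralAtZero ∧ (reg.scheme 0 0 0).HasAsymptoticScaling ∧
          ∀ m : Fin Nf → ℝ, (∀ f, 0 < m f) →
            (∀ f, ∀ᶠ k in Filter.atTop, -1 < (reg.scheme m 0 0).mq f k) ∧
              ∃ Δ > 0, (reg.scheme m 0 0).HasLatticeMassGap Δ :=
  fun h₁ h₂ => chiralLatticeHalf_of_qcd (closes h₁ h₂)

/-- **S1′ from the `DiagonalSpine` chain, NO half-spectrum lemma** (appended, lead c3 cycle 4).  `FullLatticeGap` feeds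
`LightQuarkGap`, whose consequent feeds `ChiralTuning`; its consequent carries mass scaling (H1), two-loop asymptotic
scaling (H2), the physical branch with a FULL uniform lattice gap at every positive tuple (H3), lattice non-decoupling
(H4, unused) and the eventual Goldstone lower bound G, which IS `reg.HasGoldstoneBound`
(`QCDRegularisation.hasGoldstoneBound_iff`) and implies `reg.IsChiralAtZero` (`HasGoldstoneBound.isChiralAtZero`).
So the registered anchor `stub_chiralLatticeHalf` is implied by the three EXISTING open cruxes stmt-QuantumFields-8928
→ 14656 → 17436 directly — r4's bracket went through the thin anchor and needed `TorusHalfSpectrum` (stmt-9508, found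
misstated as filed) only because it had discarded the full gap first. [folklore] -/
theorem chiralLatticeHalf_of_diagonalSpine :
    Summit.QuantumFields.QCD.Theses.DiagonalSpine.FullLatticeGap →
      Summit.QuantumFields.QCD.Theses.DiagonalSpine.LightQuarkGap →
        Summit.QuantumFields.QCD.Theses.DiagonalSpine.ChiralTuning →
          ∀ Nf : ℕ, Nf = 2 ∨ Nf = 3 → ∃ reg : QCDRegularisation Nf,
            reg.HasMassScaling ∧ reg.IsChiralAtZero ∧ (reg.scheme 0 0 0).HasAsymptoticScaling ∧
              ∀ m : Fin Nf → ℝ, (∀ f, 0 < m f) →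
                (∀ f, ∀ᶠ k in Filter.atTop, -1 < (reg.scheme m 0 0).mq f k) ∧
                  ∃ Δ > 0, (reg.scheme m 0 0).HasLatticeMassGap Δ := by
  intro hF hL hC Nf hNf
  obtain ⟨reg, h1, h2, h3, -, hG⟩ := hC Nf hNf (hL Nf hNf (hF Nf hNf))
  exact ⟨reg, h1, ((QCDRegularisation.hasGoldstoneBound_iff reg).2 hG).isChiralAtZero, h2, h3⟩

end Summit.QuantumFields.QCD.Cruxes.ThinQCD.Registered

end
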